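import Summits.Ventures.PercRepro.C026PassM

/-!
# C6-HALL: the residual of C-026 injects into the free pair-cell supersets (p5, gen 7)

mine-3's claim of record for C-026 (14:43:58Z; lead 14:50:07Z; dossier §11 S6): after the two tree
passes `τ₅₀ = kSwapSealed c b` (on `BotM ∧ O1`, into `ac|b`) and `τ₁₈ = kSwapSealed c a` (on
`BotM ∧ O2 ∧ ¬O1`, into `bc|a`), the **residual** `KL = BotM ∧ ¬O1 ∧ ¬O2` injects into the **free**
pair-cell configurations — those not used by the two tree passes — by supersets (`ω ≤ f ω`).

* `O1` / `O2` (the two offers), `KL` (the residual), `FreeAC` / `FreeBC` (the free targets);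
* **`C6Hall a b c`** — `∃ f, Set.InjOn f KL ∧ ∀ ω ∈ KL, ω ≤ f ω ∧ (FreeAC (f ω) ∨ FreeBC (f ω))`;
* **`card_botM_le_of_c6Hall`** — the three pieces `τ₅₀`, `τ₁₈`, `f` assemble to an injection
  `BotM ↪ ac|b ⊔ bc|a`, hence `(CF′)`; **`C6HallSimpleUpTo N`**, **`C026UpTo_of_c6Hall`**.
-/

namespace PercRepro

open Finset

namespace MultiGraph

section Hall

variable {V E : Type*} (G : MultiGraph V E)

/-- **The first offer** `O1`: `S ∈ bot` and `τ₅₀(S) ∈ ac|b`. -/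
def O1 (ω : Config E) (a b c : V) : Prop := G.IsBot ω a b c ∧ G.CellAC (G.kSwapSealed c b ω) a b c

/-- **The second offer** `O2`: `S ∈ bot` and `τ₁₈(S) ∈ bc|a`. -/
def O2 (ω : Config E) (a b c : V) : Prop := G.IsBot ω a b c ∧ G.CellBC (G.kSwapSealed c a ω) a b c

/-- **The residual** `KL`: bad, in `bot`, with neither offer. -/
def KL (ω : Config E) (a b c : V) : Prop := G.BotM ω a b c ∧ ¬ G.O1 ω a b c ∧ ¬ G.O2 ω a b c

/-- **The free `ac|b` targets**: the configurations of `ac|b` not used by `τ₅₀` on `BotM ∧ O1`. -/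
def FreeAC (T : Config E) (a b c : V) : Prop :=
  G.CellAC T a b c ∧ ∀ ω, G.BotM ω a b c → G.O1 ω a b c → G.kSwapSealed c b ω ≠ T

/-- **The free `bc|a` targets**: the configurations of `bc|a` not used by `τ₁₈` on `BotM ∧ O2 ∧ ¬O1`. -/
def FreeBC (T : Config E) (a b c : V) : Prop :=
  G.CellBC T a b c ∧ ∀ ω, G.BotM ω a b c → G.O2 ω a b c → ¬ G.O1 ω a b c → G.kSwapSealed c a ω ≠ T

/-- **C6-HALL** (mine-3's claim of record, dossier §11 S6): an injection of the residual `KL` into the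
free pair-cell configurations by supersets. -/
def C6Hall (a b c : V) : Prop :=
  ∃ f : Config E → Config E, Set.InjOn f {ω | G.KL ω a b c} ∧
    ∀ ω, G.KL ω a b c → ω ≤ f ω ∧ (G.FreeAC (f ω) a b c ∨ G.FreeBC (f ω) a b c)

open Classical in
/-- **The assembled map** `Φ`: `τ₅₀` on `O1`, `τ₁₈` on `O2 ∖ O1`, `f` elsewhere. -/
noncomputable def hallMap (f : Config E → Config E) (a b c : V) (ω : Config E) : Config E :=
  if G.O1 ω a b c then G.kSwapSealed c b ω else if G.O2 ω a b c then G.kSwapSealed c a ω else f ω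

/-- `Φ` on an `O1` configuration. -/
theorem hallMap_of_o1 {f : Config E → Config E} {a b c : V} {ω : Config E} (h : G.O1 ω a b c) :
    G.hallMap f a b c ω = G.kSwapSealed c b ω := by
  simp [hallMap, h]

/-- `Φ` on an `O2 ∖ O1` configuration. -/
theorem hallMap_of_o2 {f : Config E → Config E} {a b c : V} {ω : Config E} (h1 : ¬ G.O1 ω a b c)
    (h2 : G.O2 ω a b c) : G.hallMap f a b c ω = G.kSwapSealed c a ω := by
  simp [hallMap, h1, h2]

/-- `Φ` on a residual configuration. -/
theorem hallMap_of_kl {f : Config E → Config E} {a b c : V} {ω : Config E} (h : G.KL ω a b c) :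
    G.hallMap f a b c ω = f ω := by
  simp [hallMap, h.2.1, h.2.2]

/-- Every `BotM` configuration is `O1`, `O2 ∖ O1` or residual. -/
theorem o1_or_o2_or_kl {a b c : V} {ω : Config E} (h : G.BotM ω a b c) :
    G.O1 ω a b c ∨ (¬ G.O1 ω a b c ∧ G.O2 ω a b c) ∨ G.KL ω a b c := by
  by_cases h1 : G.O1 ω a b c
  · exact Or.inl h1
  by_cases h2 : G.O2 ω a b c
  · exact Or.inr (Or.inl ⟨h1, h2⟩)
  · exact Or.inr (Or.inr ⟨h, h1, h2⟩)

/-- `Φ` lands in `ac|b ⊔ bc|a` on `BotM`. -/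
theorem hallMap_cell {f : Config E → Config E} {a b c : V}
    (hf : ∀ ω, G.KL ω a b c → ω ≤ f ω ∧ (G.FreeAC (f ω) a b c ∨ G.FreeBC (f ω) a b c))
    {ω : Config E} (h : G.BotM ω a b c) :
    G.CellAC (G.hallMap f a b c ω) a b c ∨ G.CellBC (G.hallMap f a b c ω) a b c := by
  rcases G.o1_or_o2_or_kl h with h1 | ⟨h1, h2⟩ | hkl
  · rw [G.hallMap_of_o1 h1]
    exact Or.inl h1.2
  · rw [G.hallMap_of_o2 h1 h2]
    exact Or.inr h2.2
  · rw [G.hallMap_of_kl hkl]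
    rcases (hf ω hkl).2 with hfree | hfree
    · exact Or.inl hfree.1
    · exact Or.inr hfree.1

/-- **`Φ` is injective on `BotM`**: the three pieces are injective and their images are disjoint
(`τ₅₀` lands in `ac|b`, `τ₁₈` in `bc|a`, `f` in the free targets of either cell). -/
theorem hallMap_injOn {f : Config E → Config E} {a b c : V}
    (hinj : Set.InjOn f {ω | G.KL ω a b c})
    (hf : ∀ ω, G.KL ω a b c → ω ≤ f ω ∧ (G.FreeAC (f ω) a b c ∨ G.FreeBC (f ω) a b c)) :
    Set.InjOn (G.hallMap f a b c) {ω | G.BotM ω a b c} := by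
  intro ω hω ω' hω' heq
  simp only [Set.mem_setOf_eq] at hω hω'
  rcases G.o1_or_o2_or_kl hω with h1 | ⟨h1, h2⟩ | hkl <;>
    rcases G.o1_or_o2_or_kl hω' with h1' | ⟨h1', h2'⟩ | hkl'
  · -- O1 / O1
    rw [G.hallMap_of_o1 h1, G.hallMap_of_o1 h1'] at heq
    exact G.kSwapSealed_injective c b heq
  · -- O1 / O2: `ac|b` meets `bc|a`
    rw [G.hallMap_of_o1 h1, G.hallMap_of_o2 h1' h2'] at heq
    have hAC : G.CellAC (G.kSwapSealed c a ω') a b c := by rw [← heq]; exact h1.2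
    exact (G.not_cellAC_and_cellBC hAC h2'.2).elim
  · -- O1 / KL: the free target is not a `τ₅₀`-image, or `ac|b` meets `bc|a`
    rw [G.hallMap_of_o1 h1, G.hallMap_of_kl hkl'] at heq
    rcases (hf ω' hkl').2 with hfree | hfree
    · exact (hfree.2 ω hω h1 heq).elim
    · have hAC : G.CellAC (f ω') a b c := by rw [← heq]; exact h1.2
      exact (G.not_cellAC_and_cellBC hAC hfree.1).elim
  · -- O2 / O1
    rw [G.hallMap_of_o2 h1 h2, G.hallMap_of_o1 h1'] at heq
    have hAC : G.CellAC (G.kSwapSealed c a ω) a b c := by rw [heq]; exact h1'.2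
    exact (G.not_cellAC_and_cellBC hAC h2.2).elim
  · -- O2 / O2
    rw [G.hallMap_of_o2 h1 h2, G.hallMap_of_o2 h1' h2'] at heq
    exact G.kSwapSealed_injective c a heq
  · -- O2 / KL
    rw [G.hallMap_of_o2 h1 h2, G.hallMap_of_kl hkl'] at heq
    rcases (hf ω' hkl').2 with hfree | hfree
    · have hBC : G.CellBC (f ω') a b c := by rw [← heq]; exact h2.2
      exact (G.not_cellAC_and_cellBC hfree.1 hBC).elim
    · exact (hfree.2 ω hω h2 h1 heq).elim
  · -- KL / O1
    rw [G.hallMap_of_kl hkl, G.hallMap_of_o1 h1'] at heq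
    rcases (hf ω hkl).2 with hfree | hfree
    · exact (hfree.2 ω' hω' h1' heq.symm).elim
    · have hAC : G.CellAC (f ω) a b c := by rw [heq]; exact h1'.2
      exact (G.not_cellAC_and_cellBC hAC hfree.1).elim
  · -- KL / O2
    rw [G.hallMap_of_kl hkl, G.hallMap_of_o2 h1' h2'] at heq
    rcases (hf ω hkl).2 with hfree | hfree
    · have hBC : G.CellBC (f ω) a b c := by rw [heq]; exact h2'.2
      exact (G.not_cellAC_and_cellBC hfree.1 hBC).elim
    · exact (hfree.2 ω' hω' h2' h1' heq.symm).elim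
  · -- KL / KL
    rw [G.hallMap_of_kl hkl, G.hallMap_of_kl hkl'] at heq
    exact hinj hkl hkl' heq

variable [Fintype E] [DecidableEq E]

open Classical in
/-- **C6-HALL gives `(CF′)`**: `#BotM ≤ #(ac|b) + #(bc|a)`. -/
theorem card_botM_le_of_c6Hall {a b c : V} (h : G.C6Hall a b c) :
    (Finset.univ.filter fun ω : Config E => G.BotM ω a b c).card ≤
      (Finset.univ.filter fun ω : Config E => G.Conn ω a c ∧ ¬ G.Conn ω a b).card +
        (Finset.univ.filter fun ω : Config E => G.Conn ω b c ∧ ¬ G.Conn ω a b).card := by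
  obtain ⟨f, hinj, hf⟩ := h
  have h2 : (Finset.univ.filter fun ω : Config E => G.CellAC ω a b c ∨ G.CellBC ω a b c).card =
      (Finset.univ.filter fun ω : Config E => G.Conn ω a c ∧ ¬ G.Conn ω a b).card +
        (Finset.univ.filter fun ω : Config E => G.Conn ω b c ∧ ¬ G.Conn ω a b).card := by
    rw [← Finset.card_union_of_disjoint]
    · congr 1
      ext ω
      simp only [Finset.mem_filter, Finset.mem_univ, true_and, Finset.mem_union, CellAC, CellBC]
    · rw [Finset.disjoint_left]
      intro ω h1 h2
      simp only [Finset.mem_filter, Finset.mem_univ, true_and] at h1 h2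
      exact G.not_cellAC_and_cellBC h1 h2
  rw [← h2]
  refine Finset.card_le_card_of_injOn (G.hallMap f a b c) ?_ ?_
  · intro ω hω
    simp only [Finset.coe_filter, Finset.mem_univ, true_and, Set.mem_setOf_eq] at hω ⊢
    exact G.hallMap_cell hf hω
  · intro ω hω ω' hω' heq
    simp only [Finset.coe_filter, Finset.mem_univ, true_and, Set.mem_setOf_eq] at hω hω'
    exact G.hallMap_injOn hinj hf hω hω' heq

end Hall

end MultiGraph

/-- **C6-HALL on the simple graphs with ≤ N vertices and three distinct marks.** -/
def C6HallSimpleUpTo (N : ℕ) : Prop :=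
  ∀ {V E : Type} [Fintype V] [Fintype E] [DecidableEq E], Fintype.card V ≤ N →
    ∀ (G : MultiGraph V E), G.IsSimple → ∀ a b c : V, a ≠ b → a ≠ c → b ≠ c → G.C6Hall a b c

/-- **C-026 on every multigraph with ≤ N vertices, at every `p`, from C6-HALL on the simple graphs with
≤ N vertices** — mine-3's claim of record (the residual route). -/
theorem C026UpTo_of_c6Hall {N : ℕ} (h : C6HallSimpleUpTo N) : C026UpTo N := by
  refine C026UpTo_of_simpleInj ?_
  intro V E _ _ _ hV G hs m hm
  have hm' : m = ![m 0, m 1, m 2] := by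
    funext i
    fin_cases i <;> rfl
  rw [hm', G.cubeSumQuad_kernel26_nonneg_iff_M]
  exact G.card_botM_le_of_c6Hall (h hV G hs (m 0) (m 1) (m 2) (fun h01 => absurd (hm h01) (by decide))
    (fun h02 => absurd (hm h02) (by decide)) (fun h12 => absurd (hm h12) (by decide)))

end PercRepro
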